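/- Copyright: the b2b-balaban cell (near-miss cell 7), T⁴-continuum fan-out, lineage t4-ne7b-p1 (node U5c COUNT
member).  Released under the licence of the surrounding project. -/
import Summits.QuantumFields.BalabanUV.T4Continuum.Support.HistoryBankingJoinLag

/-!
# M5-2d (A3d), file 2∕2 — THE SHRUNK-IMAGE VOLUME LEDGER: the flat anchor ledger WITH THE LAG MULTIPLICITY OFF THE FLOORS (owner
module of row NE7b, lineage `t4-ne7b-p1` gen 50; re-open object (α), ruling R-OWNER-49-2 (3) «G-M5-2 … repair =
(α)-M5-2d», `SPEC-M5-2d-SHRUNK-IMAGE-LEDGER.v0.md`; PRE-POSITIONING ONLY)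

Summits-side support leaf of the T⁴-continuum cell (rung (B)+1 on a FINITE torus only; NOT infinite volume, NOT the
mass gap, NOT the Clay statement; NOT a proof of the spine estimate NE7b — the cell's OWN estimate, NOT PRINTED, NOT
PROVED).  [folklore] finite combinatorics and real arithmetic over the lineage's own bricks (M5-1b
`HistoryBankingFlatJunction`, A3b `HistoryBankingPedigreeLedger.perStep` — whose input, A1's footprint decay
`card_closureIdx_Qfrom_le_card`, IS the model's S-image shrink —, A2 `HistoryBankingFlatLedger.flat_total_le`, A3c
`HistoryBankingFloors.sum_ncomp_floorK_le_lifeCost`, `HistoryBankingBirthBookings`); nothing printed is asserted, no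
cite-tagged hypothesis, no `def … : Prop`, zero `sorry`.  One `def` (the explicit coefficient `cvol`); the joins within the
lag (`nj`, `jfee`, `compSum_one_lag_le`, `jfee_le_bfee`) are the sibling `HistoryBankingJoinLag` (file 1∕2).  B16 =
[Balaban1989LargeFieldII] pp. 384–385 under audit; locators only.

WHY (located debt G-M5-2 of ruling R-OWNER-49-2; refuter PRICING-NE7b v18 F96; balaban-calc G37).  M5-1b's
`flat_volume_le_lifeCost` asks `u_t·6·(561^d·j·L_u + 1122^d·L_u) ≤ floorK C K R t`: the lag `j` and the growth `L_u`
MULTIPLY the floor exchange, because A2 shifts BOTH lagged terms of the per-step inequality (components alive at `m − j`,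
births within the lag) to the paying step with the growth display, and the births' fee is booked through the floors.  In
print ([B16] (1.80)–(1.81)) a pending component's level cost is its SHRINKING image plus a size-free collar — no lag
multiplicity on the per-level reserve.  THIS FILE re-books the SAME per-step inequality: (i) the component count drops
only at joins, `N(m−j) ≤ N(m) + nj_j(m)` (`compSum_one_lag_le`), so the collar is charged to the floors AT THE PAYING
LEVEL — display `u_t·σ ≤ floorK C K R t`, `σ` free of the lag and of the growth; (ii) joins and births within the lag are
`j` levels each under ONE cumulative growth letter `Γ` (`u_n ≤ Γ·u_t`, `t ≤ n`), and a join is charged to a birth below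
it (`jfee_le_bfee`, the root-step potential) — both go to the class-linear content `blin` (M5-2c's birth-credit slack);
(iii) the feedback `ε₀·V(m−j)` is absorbed as before (`1122^d·16·21^d·Γ ≤ 2^j∕2`).

WHAT.  §2 **`shrunk_volume_le`**
(raw, any `σ > 0`): `Σ_{m≤K} u_m·V(m) ≤ (2 + 2·1122^d∕σ)·lifeCost + (2^{d+3} + 2·1122^d·j·Γ² + 2·561^d·j·Γ)·blin u P`.
§3 **`cvol d j Γ = 2^{d+3} + 2·1122^d·j·Γ² + 2·561^d·j·Γ`** and the CALIBRATED **`shrunk_volume_le_lifeCost`**: under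
`u_t·(6·1122^d) ≤ floorK C K R t` (`t ≤ K`) — NO LAG, NO GROWTH LETTER IN THE FLOOR EXCHANGE — and M5-1a's
`u·15·126^d ≤ E₂R^{q′}`, `u·24·126^d ≤ E₃R^{q′}`: `Σ_{m≤K} u_m·V(m) ≤ lifeCost … G + cvol d j Γ·blin u P` (M5-1b's
right-hand side KIND; M5-2c's `pshapeTH_mul_exp_le_shapeTH_of_weighted` takes any weight).
CENSUS NOTE (honest, not a kernel fact).  The floor exchange drops from `6(561^d·j·L_u + 1122^d·L_u)` to `6·1122^d`; the
remaining constant is the MODEL's collar (A1: a dead orbit in a radius-`280` box, `561^d` cubes per anchor; `2^d` anchors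
per coalesced footprint) where print's is a `64MR`-cube ([B16] p. 384) and print's reserve (1.80) IS the collar's cost —
priced by the refuter ∕ balaban-calc, not here.
WHAT IS *NOT* DONE HERE.  The `genT` headline and the M5-2c plug twins (`HistoryBankingShrunkWitness`), the displays'
supplier at print's letter (`Γ := 1 + β₀` ∕ the lattice letter), the record twin.  HONEST: the lineage's own bookkeeping;
NE7b NOT proved; spine 0∕9.  HONEST DEPENDENCY (cell): continuum YM on T⁴ ⇐ BetaPertH ∧ nine spine estimates (0∕9
proved); BetaPertH ⇐ (D1) ∧ (D4) ∧ CAP+tail.  This file changes none of it.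
-/

open Finset
open Literature.MathematicalPhysics.QuantumFieldTheory.Balaban1983to89
open Literature.MathematicalPhysics.QuantumFieldTheory.Balaban1983to89.B13ScaleTransfer
open Literature.MathematicalPhysics.QuantumFieldTheory.Balaban1983to89.B16SProfile
open Literature.MathematicalPhysics.QuantumFieldTheory.Balaban1983to89.B16StoppingRule
open T4PersistenceDictionary T4PrintedShapeBanking T4TaggedShapeBanking T4BankedInduction T4BranchingRecordsGas
open Summit.QuantumFields.BalabanUV.T4Continuum.HistoryAdmissible
open Summit.QuantumFields.BalabanUV.T4Continuum.HistoryRealise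
open Summit.QuantumFields.BalabanUV.T4Continuum.HistoryRealiseWeak
open Summit.QuantumFields.BalabanUV.T4Continuum.HistoryBankingPedigreeMax
open Summit.QuantumFields.BalabanUV.T4Continuum.HistoryBankingPedigreeLedger
open Summit.QuantumFields.BalabanUV.T4Continuum.HistoryBankingFloors
open Summit.QuantumFields.BalabanUV.T4Continuum.HistoryBankingBirthBookings
open Summit.QuantumFields.BalabanUV.T4Continuum.HistoryBankingFlatLedger
open Summit.QuantumFields.BalabanUV.T4Continuum.HistoryBankingFlatJunction

open Summit.QuantumFields.BalabanUV.T4Continuum.HistoryBankingJoinLag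

namespace Summit.QuantumFields.BalabanUV.T4Continuum.HistoryBankingShrunkLedger

noncomputable section

open scoped Classical

variable {d : ℕ} {γ : Type*} {ε : Type*} [DecidableEq ε]

/-! ## §2 The shrunk-image ledger assembled (raw floor display) -/

section Assembly

variable {L : ℕ} {s R : ℕ → ℕ} {C : T4PrintedShapeBanking.Consts} {sh : ε → PEv}

/-- **THE SHRUNK-IMAGE LEDGER (raw displays).**  Realised pedigree observed by the cutoff (`lastStep ≤ K`), well-formed
tagged genealogy over it pending at `K`, flow `L ≥ 4` with drop control, sizes `R ≥ 1`, allowance `C.n₁ ≥ 13`,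
`E₂, E₃ ≥ 0`; unit costs `u ≥ 0` with the CUMULATIVE growth `u_n ≤ Γ·u_t` (`t ≤ n`; `Γ ≥ 0`), a lag `j ≥ 1` with
`1122^d·16·21^d·Γ ≤ 2^j∕2`; the floor display `u_t·σ ≤ floorK C K R t` (`t ≤ K`, any `σ > 0` — NO lag, NO growth letter)
and M5-1a's two:
`Σ_{m≤K} u_m·V(m) ≤ (2 + 2·1122^d∕σ)·lifeCost (dictWT sh R C.n₁) (costT sh C K R) G
  + (2^{d+3} + 2·1122^d·j·Γ² + 2·561^d·j·Γ)·blin u P`. [folklore] -/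
theorem shrunk_volume_le (hL : 4 ≤ L) (hdrop : ∀ m, DropCtl s m) (hR : ∀ t, 1 ≤ R t) (hn₁ : 13 ≤ C.n₁)
    (hE₂ : 0 ≤ C.E₂) (hE₃ : 0 ≤ C.E₃) {P : PGen (Pt d × Finset (Pt d))} {Z : Finset (Pt d)}
    (hP : RealisesW L s R P Z) {G : Gen ε} (hsh : relabel sh G = P.toGen) (hW : G.WF (dictWT sh R C.n₁)) {K : ℕ}
    (hPK : P.lastStep ≤ K) (hK : K < G.reach (dictWT sh R C.n₁)) {u : ℕ → ℝ} (hu : ∀ n, 0 ≤ u n) {Γ : ℝ}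
    (hΓ0 : 0 ≤ Γ) (hΓ : ∀ t n, t ≤ n → u n ≤ Γ * u t) {j : ℕ} (hj1 : 1 ≤ j)
    (hsmall : (1122 : ℝ) ^ d * 16 * 21 ^ d * Γ ≤ 2 ^ j / 2) {σ : ℝ} (hσ : 0 < σ)
    (huS : ∀ t, t ≤ K → u t * σ ≤ floorK C K R t)
    (huE₂ : ∀ n, n ≤ K → u n * (5 * 126 ^ d) ≤ C.E₂ * (R n : ℝ) ^ C.q')
    (huE₃ : ∀ n, n ≤ K → u n * (8 * 126 ^ d) ≤ C.E₃ * (R n : ℝ) ^ C.q') :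
    ∑ m ∈ Finset.range (K + 1), u m * compSum L s (fun v => (v : ℝ)) P m ≤
      (2 + 2 * 1122 ^ d / σ) * lifeCost (dictWT sh R C.n₁) (costT sh C K R) G
        + (2 ^ (d + 3) + 2 * 1122 ^ d * j * Γ ^ 2 + 2 * 561 ^ d * j * Γ) * blin u P := by
  set ε₀ : ℝ := 1122 ^ d * 16 * 21 ^ d / 2 ^ j with hε₀
  have hε0 : 0 ≤ ε₀ := by positivity
  have hA : P.Adm K := adm_of_realisesW P Z hP hPK
  -- the two lag-window growth forms of the cumulative display
  have hΓi : ∀ t i, i < j → u (t + i) ≤ Γ * u t := fun t i _ => hΓ t (t + i) (by omega)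
  have hΓj : ∀ t, u (t + j) ≤ Γ * u t := fun t => hΓ t (t + j) (by omega)
  have hΓK : ∀ t n, t ≤ n → n ≤ K → u n ≤ Γ * u t := fun t n htn _ => hΓ t n htn
  -- (i) the per-step inequality with the component count AT THE PAYING LEVEL
  set N : ℕ → ℝ := fun m => compSum L s (fun _ => (1 : ℝ)) P m with hNdef
  set Y' : ℕ → ℝ := fun m => youngVol L s P m + (1122 : ℝ) ^ d * (N m + (nj j P m : ℝ)) with hY'
  have hstep : ∀ m, m ≤ K → compSum L s (fun v => (v : ℝ)) P m ≤ Y' m + (561 : ℝ) ^ d * (nb j P m : ℝ)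
      + (if j ≤ m then (0 : ℝ) * (0 : ℝ) + ε₀ * compSum L s (fun v => (v : ℝ)) P (m - j) else 0) := by
    intro m _
    have hN0 : 0 ≤ N m := compSum_nonneg (fun _ => zero_le_one) P m
    have hnj0 : (0 : ℝ) ≤ (nj j P m : ℝ) := Nat.cast_nonneg _
    have hextra : (0 : ℝ) ≤ (1122 : ℝ) ^ d * (N m + (nj j P m : ℝ)) := by positivity
    by_cases hjm : j ≤ m
    · rw [if_pos hjm]
      have h := perStep hL hdrop P Z hP (t := m - j) (m := m) (by omega)
      rw [show m - (m - j) = j by omega] at h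
      have hlin := compSum_affine (L := L) (s := s)
        ((2 : ℝ) ^ d * (16 * 21 ^ d) / 2 ^ j) ((2 : ℝ) ^ d) P (m - j)
      have hfun : (fun v : ℕ => (2 : ℝ) ^ d * (16 * (21 ^ d * (v : ℝ)) / 2 ^ j + 1)) =
          fun v : ℕ => (2 : ℝ) ^ d * (16 * 21 ^ d) / 2 ^ j * (v : ℝ) + 2 ^ d := by
        funext v; ring
      rw [hfun, hlin] at h
      rw [nb_eq_recent hjm]
      have hlag := compSum_one_lag_le (L := L) (s := s) hjm P hA
      have h1122 : (561 : ℝ) ^ d * 2 ^ d = 1122 ^ d := by rw [← mul_pow]; norm_num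
      have hεid : (561 : ℝ) ^ d * ((2 : ℝ) ^ d * (16 * 21 ^ d) / 2 ^ j) = ε₀ := by
        rw [hε₀]
        have : (561 : ℝ) ^ d * ((2 : ℝ) ^ d * (16 * 21 ^ d) / 2 ^ j) = (561 ^ d * 2 ^ d) * 16 * 21 ^ d / 2 ^ j := by
          ring
        rw [this, h1122]
      have hexp : (561 : ℝ) ^ d * ((2 : ℝ) ^ d * (16 * 21 ^ d) / 2 ^ j * compSum L s (fun v => (v : ℝ)) P (m - j)
            + 2 ^ d * compSum L s (fun _ => (1 : ℝ)) P (m - j) + (recent P (m - j) m : ℝ))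
          = ε₀ * compSum L s (fun v => (v : ℝ)) P (m - j) + 1122 ^ d * compSum L s (fun _ => (1 : ℝ)) P (m - j)
            + 561 ^ d * (recent P (m - j) m : ℝ) := by
        rw [← hεid, ← h1122]; ring
      have hmono : (1122 : ℝ) ^ d * compSum L s (fun _ => (1 : ℝ)) P (m - j) ≤ 1122 ^ d * (N m + (nj j P m : ℝ)) :=
        mul_le_mul_of_nonneg_left hlag (by positivity)
      rw [hY']
      simp only
      linarith
    · rw [if_neg hjm, add_zero, hY']
      have h := compSum_id_le_of_lt_lag (show 2 ≤ L by omega) hdrop (by omega : m < j) P Z hP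
      simp only
      linarith
  -- (ii) the lagged sum (A2 with no floor term: the collar sits in `Y'`)
  have hsm : ε₀ * Γ ≤ 1 / 2 := by
    rw [hε₀]
    have h2 : (0 : ℝ) < 2 ^ j := by positivity
    rw [div_mul_eq_mul_div, div_le_iff₀ h2]
    linarith
  have hflat := flat_total_le (u := u) (V := fun m => compSum L s (fun v => (v : ℝ)) P m) (Y := Y')
    (N := fun _ => (0 : ℝ)) (R := fun m => (nb j P m : ℝ)) (K := K) (j := j) (Lu := Γ) (cA := (561 : ℝ) ^ d)
    (cF := (0 : ℝ)) (ε := ε₀) hu (fun t => compSum_nonneg (fun v => Nat.cast_nonneg v) P t) (fun _ => le_rfl)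
    hΓ0 hΓj le_rfl hε0 hstep hsm
  -- (iii) the four terms against the bookings
  have hLC0 : 0 ≤ lifeCost (dictWT sh R C.n₁) (costT sh C K R) G :=
    lifeCost_nonneg (fun G n => costT_nonneg hE₂ hE₃ G n) G
  have hY := sum_youngVol_le (K := K) (C := C) (R := R) hL hdrop hR hE₂ hE₃ hu huE₂ huE₃ P Z hP
  have hB := sum_bsum_le_lifeCost (K := K) hE₂ hE₃ hsh hW hK
  have hnb := sum_nb_le_bfee (K := K) (j := j) hu hΓi P
  have hnjs := sum_nj_le_jfee (K := K) (j := j) hu hΓi P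
  have hjb := jfee_le_bfee hu hΓ0 hΓK P hA
  have hbb := bfee_le_blin hu P
  have hbfee0 := bfee_nonneg hu P
  have hblin := blin_nonneg hu P
  have hN : ∑ m ∈ Finset.range (K + 1), u m * N m ≤ lifeCost (dictWT sh R C.n₁) (costT sh C K R) G / σ := by
    have h1 := sum_ncomp_floorK_le_lifeCost hL hdrop hR sh hn₁ hE₂ hE₃ K hP hsh hW hK
    rw [le_div_iff₀ hσ, Finset.sum_mul]
    refine le_trans (Finset.sum_le_sum fun t ht => ?_) h1
    rw [Finset.mem_range] at ht
    have hN0 := compSum_nonneg (L := L) (s := s) (fun _ => zero_le_one) P t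
    calc u t * N t * σ = (u t * σ) * compSum L s (fun _ => (1 : ℝ)) P t := by rw [hNdef]; ring
      _ ≤ floorK C K R t * compSum L s (fun _ => (1 : ℝ)) P t := mul_le_mul_of_nonneg_right (huS t (by omega)) hN0
      _ = compSum L s (fun _ => (1 : ℝ)) P t * floorK C K R t := mul_comm _ _
  -- the young-plus-collar sum
  have hY'sum : ∑ m ∈ Finset.range (K + 1), u m * Y' m =
      ∑ m ∈ Finset.range (K + 1), u m * youngVol L s P m
        + 1122 ^ d * (∑ m ∈ Finset.range (K + 1), u m * N m + ∑ m ∈ Finset.range (K + 1), u m * (nj j P m : ℝ)) := by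
    rw [hY', mul_add, Finset.mul_sum, Finset.mul_sum, ← Finset.sum_add_distrib, ← Finset.sum_add_distrib]
    exact Finset.sum_congr rfl fun m _ => by ring
  -- (iv) arithmetic
  set LC := lifeCost (dictWT sh R C.n₁) (costT sh C K R) G with hLC
  have hj0 : (0 : ℝ) ≤ j := Nat.cast_nonneg j
  have t1 : ∑ m ∈ Finset.range (K + 1), u m * (nj j P m : ℝ) ≤ j * Γ * (Γ * blin u P) := by
    refine hnjs.trans (mul_le_mul_of_nonneg_left (hjb.trans ?_) (by positivity))
    exact mul_le_mul_of_nonneg_left hbb hΓ0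
  have t2 : ∑ m ∈ Finset.range (K + 1), u m * (nb j P m : ℝ) ≤ j * Γ * blin u P :=
    hnb.trans (mul_le_mul_of_nonneg_left hbb (by positivity))
  have t3 : ∑ m ∈ Finset.range (K + 1), u m * youngVol L s P m ≤ 2 ^ d * 4 * blin u P + LC := hY.trans (by linarith)
  have t4 : (1122 : ℝ) ^ d * (∑ m ∈ Finset.range (K + 1), u m * N m
      + ∑ m ∈ Finset.range (K + 1), u m * (nj j P m : ℝ)) ≤ 1122 ^ d * (LC / σ + j * Γ * (Γ * blin u P)) :=
    mul_le_mul_of_nonneg_left (add_le_add hN t1) (by positivity)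
  have t5 : (561 : ℝ) ^ d * ∑ m ∈ Finset.range (K + 1), u m * (nb j P m : ℝ) ≤ 561 ^ d * (j * Γ * blin u P) :=
    mul_le_mul_of_nonneg_left t2 (by positivity)
  have hfin : 2 * ((2 ^ d * 4 * blin u P + LC) + 1122 ^ d * (LC / σ + j * Γ * (Γ * blin u P))
      + 561 ^ d * (j * Γ * blin u P)) =
      (2 + 2 * 1122 ^ d / σ) * LC + (2 ^ (d + 3) + 2 * 1122 ^ d * j * Γ ^ 2 + 2 * 561 ^ d * j * Γ) * blin u P := by
    rw [pow_add]; field_simp; ring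
  have hflat' : ∑ m ∈ Finset.range (K + 1), u m * compSum L s (fun v => (v : ℝ)) P m ≤
      2 * ((∑ m ∈ Finset.range (K + 1), u m * Y' m)
        + 561 ^ d * ∑ m ∈ Finset.range (K + 1), u m * (nb j P m : ℝ)) := by
    have e0 : (0 : ℝ) * Γ * ∑ m ∈ Finset.range (K + 1), u m * (0 : ℝ) = 0 := by ring
    linarith [hflat, e0.le, e0.ge]
  rw [hY'sum] at hflat'
  linarith [hflat', t3, t4, t5, hfin.le]

end Assembly

/-! ## §3 The calibrated form: coefficient one on the booked life cost, the explicit class-linear coefficient -/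

section Calibrated

/-- **THE CLASS-LINEAR COEFFICIENT OF THE SHRUNK LEDGER**: `cvol d j Γ = 2^{d+3} + 2·1122^d·j·Γ² + 2·561^d·j·Γ` — the
young images (`2^{d+3}`), the joins within the lag (`2·1122^d·j·Γ²`) and the births within the lag (`2·561^d·j·Γ`), all
against the births' class-linear content (M5-2c's birth-credit slack). [folklore] -/
def cvol (d j : ℕ) (Γ : ℝ) : ℝ := 2 ^ (d + 3) + 2 * 1122 ^ d * j * Γ ^ 2 + 2 * 561 ^ d * j * Γ

/-- the coefficient is at least `2^{d+3}` (`Γ ≥ 0`) [folklore] -/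
theorem two_pow_le_cvol (d j : ℕ) {Γ : ℝ} (hΓ0 : 0 ≤ Γ) : (2 : ℝ) ^ (d + 3) ≤ cvol d j Γ := by
  unfold cvol; nlinarith [sq_nonneg Γ, Nat.cast_nonneg (α := ℝ) j, pow_nonneg (by norm_num : (0:ℝ) ≤ 1122) d,
    pow_nonneg (by norm_num : (0:ℝ) ≤ 561) d, mul_nonneg (mul_nonneg (pow_nonneg (by norm_num : (0:ℝ) ≤ 1122) d)
    (Nat.cast_nonneg (α := ℝ) j)) (sq_nonneg Γ), mul_nonneg (mul_nonneg (pow_nonneg (by norm_num : (0:ℝ) ≤ 561) d)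
    (Nat.cast_nonneg (α := ℝ) j)) hΓ0]

/-- the coefficient is positive [folklore] -/
theorem cvol_pos (d j : ℕ) {Γ : ℝ} (hΓ0 : 0 ≤ Γ) : 0 < cvol d j Γ :=
  lt_of_lt_of_le (by positivity) (two_pow_le_cvol d j hΓ0)

variable {L : ℕ} {s R : ℕ → ℕ} {C : T4PrintedShapeBanking.Consts} {sh : ε → PEv}

/-- **THE COST SIDE OF THE TOTAL-FORM BINDER, SHRUNK LEDGER** (ruling R-OWNER-49-2 (3), M5-2d).  Under the LAG-FREE
floor display `u_t·(6·1122^d) ≤ floorK C K R t` (`t ≤ K`), M5-1a's `u_n·15·126^d ≤ E₂R_n^{q′}`,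
`u_n·24·126^d ≤ E₃R_n^{q′}` (`n ≤ K`), the cumulative growth `u_n ≤ Γ·u_t` (`t ≤ n`, `Γ ≥ 0`), a lag `j ≥ 1` with
`1122^d·16·21^d·Γ ≤ 2^j∕2`, and the hypotheses of `shrunk_volume_le`:
`Σ_{m≤K} u_m·V(m) ≤ lifeCost (dictWT sh R C.n₁) (costT sh C K R) G + cvol d j Γ·blin u P`. [folklore] -/
theorem shrunk_volume_le_lifeCost (hL : 4 ≤ L) (hdrop : ∀ m, DropCtl s m) (hR : ∀ t, 1 ≤ R t) (hn₁ : 13 ≤ C.n₁)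
    (hE₂ : 0 ≤ C.E₂) (hE₃ : 0 ≤ C.E₃) {P : PGen (Pt d × Finset (Pt d))} {Z : Finset (Pt d)}
    (hP : RealisesW L s R P Z) {G : Gen ε} (hsh : relabel sh G = P.toGen) (hW : G.WF (dictWT sh R C.n₁)) {K : ℕ}
    (hPK : P.lastStep ≤ K) (hK : K < G.reach (dictWT sh R C.n₁)) {u : ℕ → ℝ} (hu : ∀ n, 0 ≤ u n) {Γ : ℝ}
    (hΓ0 : 0 ≤ Γ) (hΓ : ∀ t n, t ≤ n → u n ≤ Γ * u t) {j : ℕ} (hj1 : 1 ≤ j)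
    (hsmall : (1122 : ℝ) ^ d * 16 * 21 ^ d * Γ ≤ 2 ^ j / 2)
    (huS : ∀ t, t ≤ K → u t * (6 * 1122 ^ d) ≤ floorK C K R t)
    (huE₂ : ∀ n, n ≤ K → u n * (15 * 126 ^ d) ≤ C.E₂ * (R n : ℝ) ^ C.q')
    (huE₃ : ∀ n, n ≤ K → u n * (24 * 126 ^ d) ≤ C.E₃ * (R n : ℝ) ^ C.q') :
    ∑ m ∈ Finset.range (K + 1), u m * compSum L s (fun v => (v : ℝ)) P m ≤
      lifeCost (dictWT sh R C.n₁) (costT sh C K R) G + cvol d j Γ * blin u P := by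
  -- apply the raw form to `u′ := 3u` with `σ := 2·1122^d`: coefficient `2 + 1 = 3`
  set σ : ℝ := 2 * 1122 ^ d with hσdef
  have hσ : 0 < σ := by rw [hσdef]; positivity
  have hu' : ∀ n, 0 ≤ 3 * u n := fun n => by linarith [hu n]
  have hΓ' : ∀ t n, t ≤ n → 3 * u n ≤ Γ * (3 * u t) := fun t n htn => by nlinarith [hΓ t n htn]
  have huS' : ∀ t, t ≤ K → 3 * u t * σ ≤ floorK C K R t := fun t ht => by
    have := huS t ht; rw [hσdef]; linarith
  have huE₂' : ∀ n, n ≤ K → 3 * u n * (5 * 126 ^ d) ≤ C.E₂ * (R n : ℝ) ^ C.q' := fun n hn => by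
    have := huE₂ n hn; linarith
  have huE₃' : ∀ n, n ≤ K → 3 * u n * (8 * 126 ^ d) ≤ C.E₃ * (R n : ℝ) ^ C.q' := fun n hn => by
    have := huE₃ n hn; linarith
  have h := shrunk_volume_le (u := fun n => 3 * u n) hL hdrop hR hn₁ hE₂ hE₃ hP hsh hW hPK hK hu' hΓ0 hΓ' hj1
    hsmall hσ huS' huE₂' huE₃'
  have hcoef : (2 + 2 * 1122 ^ d / σ : ℝ) = 3 := by
    rw [hσdef]; field_simp; ring
  rw [hcoef] at h
  have hb : blin (fun n => 3 * u n) P = 3 * blin u P := blin_smul 3 u P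
  have hs : ∑ m ∈ Finset.range (K + 1), 3 * u m * compSum L s (fun v => (v : ℝ)) P m =
      3 * ∑ m ∈ Finset.range (K + 1), u m * compSum L s (fun v => (v : ℝ)) P m := by
    rw [Finset.mul_sum]; exact Finset.sum_congr rfl fun m _ => by ring
  rw [hb, hs] at h
  unfold cvol
  linarith

end Calibrated

end

end Summit.QuantumFields.BalabanUV.T4Continuum.HistoryBankingShrunkLedger
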